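import Summits.AtomisticToContinuum.BoseEinsteinCondensation.Theorems.BECStronglyRayleighInsertionFieldDelocalisationLinearVoidTailPrelim
import Literature.Combinatorics.StablePolynomials.NegativeCorrelationVoid
import Literature.Combinatorics.StablePolynomials.InsertionFamilies
import Summits.AtomisticToContinuum.BoseEinsteinCondensation.Theorems.InsertionFieldDelocalisation.Negative.Tightness
import Summits.AtomisticToContinuum.BoseEinsteinCondensation.Theorems.InsertionFieldDelocalisation.Negative.PerronExistence
import HarnessLib

/-!
# The amplitude-LINEAR pinned void tail (helper for `stub_voidTail`, line `mobile-trap-dirichlet-eigenfunction`,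
# crux `BECStronglyRayleigh.InsertionFieldDelocalisation`, stmt-AtomisticToContinuum-9673)

What Theorem S (`GroundStateStability_proof`) DOES give towards the registered stub `stub_voidTail`
(the void tail under the Born-rule weights `(r^T_x)²`, reported `stub-blocked` by the line's worker
as equivalent to a pinned Born-rule emptiness-formation bound): the same statement for the
amplitude-LINEAR pinned weights `r^T_x` themselves,

  `Σ_{T ∩ B = ∅} r^T_x ≤ exp(2 - (N/L³)·|B|) · Σ_T r^T_x`      (`linearPinnedVoidTail`)

for every admissible `(L, N, ψ)`, every insertion site `x` and every finite set `B` of sites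
(`r^T_x = Negative.field ψ T x`). Proof: `T ↦ r^T_x` is the coefficient family of
`(Σ_y ∂_y) ∂_x Σ_S Re ψ(1_S) z^S`, hence "stable or zero" by Theorem S on the torus
(`lvt_amplitudes_stable`) and the preservers of `Literature/Combinatorics/StablePolynomials/InsertionFamilies.lean`;
the void bound `multiAffine_void_le_exp` (`NegativeCorrelationVoid.lean`: pairwise negative
correlation + stability of conditioning, no negative-association theorem needed) gives
`P(T ∩ B = ∅) ≤ exp(-Σ_{b∈B} P(b ∈ T))`, and `Σ_{b∈B} P(b ∈ T) ≥ ν|B| - 2` by double counting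
(`Σ_b P(b ∈ T) = N - 2`, supports are `(N-2)`-sets) and `P(b ∈ T) ≤ ν` (pairwise negative
correlation of `{x ∈ S}`, `{b ∈ S}` under `S ↦ Re ψ(1_S)` + translation invariance of the
one-point sums, `lvt_onePoint_const`, from the landed `stub_translationInvariance`). The
quadratic (Born) version does NOT follow: `P_Born(void) = P_lin(void)²·exp(ΔH₂)` with an
uncontrolled collision-entropy drop (the "measure knot").
-/

noncomputable section

namespace Summit.AtomisticToContinuum.BoseEinsteinCondensation.Cruxes.InsertionFieldDelocalisation.MobileTrapDirichletEigenfunction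

open scoped BigOperators
open Literature.MathematicalPhysics.QuantumLattice Literature.Probability.LatticeModels Finset
open Summit.AtomisticToContinuum.BoseEinsteinCondensation.Theorems.InsertionFieldDelocalisation.Negative

section Main

open Literature.Combinatorics.StablePolynomials
  (multiAffine_stableOrZero_derivFamily multiAffine_stableOrZero_sumInsertFamily
    multiAffine_pairwise_negCorr multiAffine_void_le_exp)

/-- **The amplitude-LINEAR pinned void tail** (the linear half of `stub_voidTail`). For every
admissible datum `(L, N, ψ)` of the crux, every insertion site `x` and every finite set `B` of
sites, the `r^T_x`-weighted fraction of backgrounds `T` avoiding `B` is at most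
`exp(2 - (N/L³)·|B|)`:

  `Σ_{T ∩ B = ∅} r^T_x ≤ exp(2 - ν |B|) · Σ_T r^T_x`,  `r^T_x = field ψ T x`, `ν = N/L³`.

Proof: `T ↦ r^T_x` is the coefficient family of `(Σ_y ∂_y) ∂_x Σ_S Re ψ(1_S) z^S`, hence
"stable or zero" by Theorem S (`GroundStateStability_proof`) and the preservers
`multiAffine_stableOrZero_derivFamily`, `multiAffine_stableOrZero_sumInsertFamily`; it is
nonnegative, so the void bound `multiAffine_void_le_exp` gives
`P(T ∩ B = ∅) ≤ exp(-Σ_{b∈B} P(b ∈ T))`; and `Σ_{b ∈ B} P(b ∈ T) ≥ ν|B| - 2` because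
`Σ_b P(b ∈ T) = N - 2` (supports are `(N-2)`-sets) while each `P(b ∈ T) ≤ ν` by pairwise
negative correlation of `{x ∈ S}` and `{b ∈ S}` under `S ↦ Re ψ(1_S)` (`multiAffine_pairwise_negCorr`)
and translation invariance of the one-point sums (`lvt_onePoint_const`). The Born-rule
(quadratic-weight) analogue is the registered `stub_voidTail`, which does NOT follow from this.
[folklore] -/
theorem linearPinnedVoidTail :
    ∀ (L : ℕ) [NeZero L], 2 ≤ L → ∀ N : ℕ, 2 ≤ N → 2 * N ≤ L ^ 3 →
      ∀ ψ : TensorIndex (TorusSite 3 L) 2 → ℂ,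
        ψ ∈ spinZSector 1 ((N : ℝ) - (L : ℝ) ^ 3 / 2) → ψ ≠ 0 →
        (xyTorus 3 L 1).mulVec ψ =
          ((lowestEnergyInSector 1 (xyTorus 3 L 1) ((N : ℝ) - (L : ℝ) ^ 3 / 2) : ℝ) : ℂ) • ψ →
        (∀ σ, 0 ≤ (ψ σ).re ∧ (ψ σ).im = 0) →
        ∀ (x : TorusSite 3 L) (B : Finset (TorusSite 3 L)),
          (∑ T ∈ univ.filter (fun T : Finset (TorusSite 3 L) => Disjoint B T), field ψ T x) ≤
            Real.exp (2 - (N : ℝ) / (L : ℝ) ^ 3 * B.card) * ∑ T : Finset (TorusSite 3 L), field ψ T x := by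
  intro L _ hL N hN hNL ψ hψK hψ0 hH hnn x B
  -- the real amplitude family and its support
  set a : Finset (TorusSite 3 L) → ℝ := fun S => (ψ (fun i => if i ∈ S then 0 else 1)).re with ha
  have ha0 : ∀ S, 0 ≤ a S := fun S => (hnn _).1
  have hsupp : ∀ S, a S ≠ 0 → S.card = N := by
    intro S hS
    have hS' : ψ (fun i => if i ∈ S then 0 else 1) ≠ 0 := by
      intro h
      apply hS
      simp only [ha, h, Complex.zero_re]
    have hmag := (LiebMattis.mem_spinZSector_iff 1 ((N : ℝ) - (L : ℝ) ^ 3 / 2) ψ).mp hψK _ hS'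
    rw [magnetisation_ind, card_torusSite] at hmag
    have h : (S.card : ℂ) = (N : ℂ) := by
      have := hmag
      push_cast at this
      linear_combination this
    exact_mod_cast h
  -- Theorem S, real coefficient form: the family `a` is zero-free on `H^Λ`
  have hstab : (∀ S, a S = 0) ∨ ∀ z : TorusSite 3 L → ℂ, (∀ i, 0 < (z i).im) →
      (∑ S : Finset (TorusSite 3 L), (a S : ℂ) * ∏ i ∈ S, z i) ≠ 0 :=
    Or.inr (lvt_amplitudes_stable L hψK hψ0 hH hnn)
  -- the pinned field as the polarised derivative of the derivative family
  set a1 : Finset (TorusSite 3 L) → ℝ := fun S => if x ∈ S then 0 else a (insert x S) with ha1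
  have ha1st := multiAffine_stableOrZero_derivFamily a hstab x
  set c : Finset (TorusSite 3 L) → ℝ := fun T => ∑ y ∈ Tᶜ, a1 (insert y T) with hcdef
  have hcst : (∀ T, c T = 0) ∨ ∀ z : TorusSite 3 L → ℂ, (∀ i, 0 < (z i).im) →
      (∑ T : Finset (TorusSite 3 L), (c T : ℂ) * ∏ i ∈ T, z i) ≠ 0 :=
    multiAffine_stableOrZero_sumInsertFamily a1 ha1st
  have hc_field : ∀ T, c T = field ψ T x := by
    intro T
    have hf : ∀ y : TorusSite 3 L,
        (if x ∉ T ∧ y ∉ T ∧ x ≠ y then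
            (ψ (fun z => if z ∈ insert x (insert y T) then 0 else 1)).re else 0) =
          if y ∈ Tᶜ then a1 (insert y T) else 0 := by
      intro y
      simp only [ha1, ha, Finset.mem_compl, Finset.mem_insert]
      by_cases hyT : y ∈ T
      · rw [if_neg (fun h => h.2.1 hyT), if_neg (not_not.2 hyT)]
      · rw [if_pos hyT]
        by_cases hx : x = y ∨ x ∈ T
        · rw [if_pos hx, if_neg]
          rintro ⟨hxT, -, hxy⟩
          rcases hx with h | h
          · exact hxy h
          · exact hxT h
        · rw [if_neg hx, if_pos]
          push Not at hx
          exact ⟨hx.2, hyT, hx.1⟩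
    rw [field]
    simp only [hf]
    rw [Finset.sum_ite_mem, Finset.univ_inter]
  have hc0 : ∀ T, 0 ≤ c T := fun T => by
    rw [hc_field]
    exact field_nonneg ψ (fun σ => (hnn σ).1) T x
  -- explicit form of `c` (for the counting lemmas)
  have hc_sum : ∀ T, c T = ∑ y : TorusSite 3 L,
      (if x ∉ T ∧ y ∉ T ∧ x ≠ y then a (insert x (insert y T)) else 0) := by
    intro T
    rw [hc_field]
    rfl
  have hcsupp : ∀ T, c T ≠ 0 → T.card = N - 2 := by
    intro T hT
    rw [hc_sum] at hT
    obtain ⟨y, -, hy⟩ := Finset.exists_ne_zero_of_sum_ne_zero hT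
    have hcond : x ∉ T ∧ y ∉ T ∧ x ≠ y := by
      by_contra h
      exact hy (if_neg h)
    rw [if_pos hcond] at hy
    have hcard := hsupp _ hy
    rw [Finset.card_insert_of_notMem, Finset.card_insert_of_notMem hcond.2.1] at hcard
    · omega
    · simp only [Finset.mem_insert, not_or]
      exact ⟨hcond.2.2, hcond.1⟩
  -- rewrite the goal in terms of `c`
  have hgoal : (∑ T ∈ univ.filter (fun T : Finset (TorusSite 3 L) => Disjoint B T), field ψ T x) =
      ∑ T ∈ univ.filter (fun T : Finset (TorusSite 3 L) => Disjoint B T), c T :=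
    Finset.sum_congr rfl fun T _ => (hc_field T).symm
  have hgoal' : (∑ T : Finset (TorusSite 3 L), field ψ T x) = ∑ T : Finset (TorusSite 3 L), c T :=
    Finset.sum_congr rfl fun T _ => (hc_field T).symm
  rw [hgoal, hgoal']
  set Z := ∑ T : Finset (TorusSite 3 L), c T with hZ
  by_cases hZ0 : Z = 0
  · -- all weights vanish
    have hall : ∀ T, c T = 0 := fun T =>
      (Finset.sum_eq_zero_iff_of_nonneg fun T _ => hc0 T).1 hZ0 T (Finset.mem_univ T)
    rw [Finset.sum_eq_zero fun T _ => hall T, hZ0, mul_zero]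
  have hZpos : 0 < Z := lt_of_le_of_ne (Finset.sum_nonneg fun T _ => hc0 T) (Ne.symm hZ0)
  -- the void bound
  have hvoid := multiAffine_void_le_exp c hc0 hcst hZpos B
  -- it remains to bound the exponent: Σ_{b ∈ B} P_b ≥ ν |B| - 2
  set P : TorusSite 3 L → ℝ :=
    fun b => (∑ T ∈ univ.filter (fun T : Finset (TorusSite 3 L) => b ∈ T), c T) / Z with hP
  have hV : Fintype.card (TorusSite 3 L) = L ^ 3 := card_torusSite 3 L
  have hN3 : N ≤ L ^ 3 := by omega
  -- (i) Σ_b P_b = N - 2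
  have hPsum : ∑ b : TorusSite 3 L, P b = (N : ℝ) - 2 := by
    simp only [hP]
    rw [← Finset.sum_div, lvt_sum_sum_mem, lvt_sum_card_mul c (N - 2) hcsupp, ← hZ,
      mul_div_assoc, div_self hZ0, mul_one, Nat.cast_sub (by omega : 2 ≤ N)]
    norm_num
  -- (ii) each P_b ≤ ν
  have hA : ∀ b b' : TorusSite 3 L,
      (∑ S ∈ univ.filter (fun S : Finset (TorusSite 3 L) => b ∈ S), a S) =
        ∑ S ∈ univ.filter (fun S : Finset (TorusSite 3 L) => b' ∈ S), a S :=
    fun b b' => lvt_onePoint_const L hL hN hNL hψK hψ0 hH hnn b b'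
  set Za := ∑ S : Finset (TorusSite 3 L), a S with hZa
  set Ax := ∑ S ∈ univ.filter (fun S : Finset (TorusSite 3 L) => x ∈ S), a S with hAx
  have hZtot : Z = ((N : ℝ) - 1) * Ax := by
    rw [hZ, hAx]
    simp only [hc_sum]
    exact lvt_total_mass a N hsupp x
  have hAxpos : 0 < Ax := by
    have h1 : (0 : ℝ) < (N : ℝ) - 1 := by
      have : (2 : ℝ) ≤ N := by exact_mod_cast hN
      linarith
    rw [hZtot] at hZpos
    by_contra h
    push Not at h
    have := mul_nonpos_of_nonneg_of_nonpos h1.le h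
    linarith
  have hZapos : 0 < Za := by
    refine lt_of_lt_of_le hAxpos ?_
    rw [hAx, hZa, ← Finset.sum_filter_add_sum_filter_not univ (fun S : Finset (TorusSite 3 L) => x ∈ S)]
    linarith [Finset.sum_nonneg (s := univ.filter fun S : Finset (TorusSite 3 L) => ¬ x ∈ S) fun S _ => ha0 S]
  have hVpos : (0 : ℝ) < (L : ℝ) ^ 3 := by positivity
  -- `Ax = N·Za / V` by translation invariance and double counting
  have hAxN : Ax * (L : ℝ) ^ 3 = N * Za := by
    have h1 : ∑ b : TorusSite 3 L, ∑ S ∈ univ.filter (fun S : Finset (TorusSite 3 L) => b ∈ S), a S =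
        (Fintype.card (TorusSite 3 L) : ℝ) * Ax := by
      rw [Finset.sum_congr rfl fun b _ => hA b x, Finset.sum_const, nsmul_eq_mul, Finset.card_univ]
    have h2 := lvt_sum_sum_mem a
    rw [lvt_sum_card_mul a N hsupp, h1, hV] at h2
    push_cast at h2
    linarith
  -- (ii) every `P b ≤ ν`
  have hPb : ∀ b : TorusSite 3 L, P b ≤ (N : ℝ) / (L : ℝ) ^ 3 := by
    intro b
    have hνnn : (0 : ℝ) ≤ (N : ℝ) / (L : ℝ) ^ 3 := by positivity
    simp only [hP]
    rw [div_le_iff₀ hZpos]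
    by_cases hbx : b = x
    · -- `x` never lies in a charged background
      subst hbx
      have h0 : ∑ T ∈ univ.filter (fun T : Finset (TorusSite 3 L) => b ∈ T), c T = 0 := by
        refine Finset.sum_eq_zero fun T hT => ?_
        rw [Finset.mem_filter] at hT
        by_contra hc
        rw [hc_sum] at hc
        obtain ⟨y, -, hy⟩ := Finset.exists_ne_zero_of_sum_ne_zero hc
        exact hy (if_neg fun h => h.1 hT.2)
      rw [h0]
      exact mul_nonneg hνnn hZpos.le
    · have hxb : x ≠ b := Ne.symm hbx
      have hincl : ∑ T ∈ univ.filter (fun T : Finset (TorusSite 3 L) => b ∈ T), c T =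
          ((N : ℝ) - 2) * ∑ S ∈ univ.filter (fun S : Finset (TorusSite 3 L) => x ∈ S ∧ b ∈ S), a S := by
        simp only [hc_sum]
        exact lvt_inclusion_mass a N hsupp hxb
      have hnc := multiAffine_pairwise_negCorr a hstab hxb
      rw [← hZa, ← hAx, hA b x] at hnc
      -- hnc : Axb * Za ≤ Ax * Ax
      set Axb := ∑ S ∈ univ.filter (fun S : Finset (TorusSite 3 L) => x ∈ S ∧ b ∈ S), a S with hAxb
      have hAxb_le : Axb * (L : ℝ) ^ 3 ≤ Ax * N := by
        -- multiply `hnc` by `L³` and use `Ax·L³ = N·Za`, then divide by `Za > 0`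
        have h1 : Axb * Za * (L : ℝ) ^ 3 ≤ Ax * (N * Za) := by
          calc Axb * Za * (L : ℝ) ^ 3 ≤ Ax * Ax * (L : ℝ) ^ 3 :=
                mul_le_mul_of_nonneg_right hnc hVpos.le
            _ = Ax * (Ax * (L : ℝ) ^ 3) := by ring
            _ = Ax * (N * Za) := by rw [hAxN]
        have h2 : (Axb * (L : ℝ) ^ 3) * Za ≤ (Ax * N) * Za := by nlinarith [h1]
        exact le_of_mul_le_mul_right h2 hZapos
      rw [hincl, hZtot]
      have hN2 : (0 : ℝ) ≤ (N : ℝ) - 2 := by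
        have : (2 : ℝ) ≤ N := by exact_mod_cast hN
        linarith
      -- (N-2)·Axb ≤ (N/L³)·(N-1)·Ax  ⟸  Axb·L³ ≤ Ax·N and N-2 ≤ N-1
      rw [div_mul_eq_mul_div, le_div_iff₀ hVpos]
      nlinarith [mul_le_mul_of_nonneg_left hAxb_le hN2, hAxpos.le, mul_nonneg hAxpos.le (Nat.cast_nonneg N)]
  -- (iii) the exponent
  have hexp : -(∑ b ∈ B, P b) ≤ 2 - (N : ℝ) / (L : ℝ) ^ 3 * B.card := by
    have hsplit : ∑ b : TorusSite 3 L, P b = (∑ b ∈ B, P b) + ∑ b ∈ Bᶜ, P b := by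
      rw [← Finset.sum_add_sum_compl B]
    have hcompl : ∑ b ∈ Bᶜ, P b ≤ (Bᶜ.card : ℝ) * ((N : ℝ) / (L : ℝ) ^ 3) := by
      rw [← nsmul_eq_mul, ← Finset.sum_const]
      exact Finset.sum_le_sum fun b _ => hPb b
    rw [Finset.card_compl, hV, Nat.cast_sub (le_trans (Finset.card_le_univ B) (le_of_eq hV))] at hcompl
    push_cast at hcompl
    have hB : ((B.card : ℕ) : ℝ) ≤ (L : ℝ) ^ 3 := by
      have := Finset.card_le_univ B
      rw [hV] at this
      exact_mod_cast this
    have key : ∑ b ∈ B, P b = ((N : ℝ) - 2) - ∑ b ∈ Bᶜ, P b := by linarith [hPsum, hsplit]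
    rw [key]
    have : ((L : ℝ) ^ 3 - B.card) * ((N : ℝ) / (L : ℝ) ^ 3) = N - (N : ℝ) / (L : ℝ) ^ 3 * B.card := by
      field_simp
    nlinarith [hcompl, this]
  -- (iv) conclude
  have hfrac : (∑ T ∈ univ.filter (fun T : Finset (TorusSite 3 L) => Disjoint B T), c T) =
      ((∑ T ∈ univ.filter (fun T : Finset (TorusSite 3 L) => Disjoint B T), c T) / Z) * Z := by
    field_simp
  rw [hfrac]
  refine mul_le_mul_of_nonneg_right (hvoid.trans (Real.exp_le_exp.2 hexp)) hZpos.le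

end Main

end Summit.AtomisticToContinuum.BoseEinsteinCondensation.Cruxes.InsertionFieldDelocalisation.MobileTrapDirichletEigenfunction

end
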